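import Literature.Geometry.Lorentzian.TameGenericity
import Literature.Geometry.Lorentzian.StronglyAsymptoticallyFlatADMEnergy

/-!
# `WeakCosmicCensorshipTame` (crux `stmt-FinalStateConjecture-17269`, route `PhaseMixingCapture`,
# rank 5), negative-side support I: a TAME family cannot change the mass discontinuously —
# burial and rescaling witness families are not tame

Support file of the crux disprover (cdisprove seat, cycle 1, 2026-08-17), `sorry`-free, no named
facts, no definitions. The crux is TAME Christodoulou-genericity (`IsTameChristodoulouGeneric … 1`)
of "an MGHD exists and every MGHD has complete `𝓘⁺`" inside `admissibleVacuumData Σ`; its only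
delta against the pre-revision crux `WeakCosmicCensorshipMGHD` (stmt-9952) is the witness notion:
curves must be tame on one fixed end `e` (`InitialDataSet.IsTameDataFamily`: every member strongly
asymptotically flat on `e` with a continuous mass function, and `e.wDist (F c) (F 0) → 0`). The
pre-revision crux was expected TRUE FOR THE WRONG REASON through exact-Kerr BURIAL families whose
mass `M(c) → ∞` (`Cruxes/WeakCosmicCensorshipMGHD/Disproof.lean` §9, §15). This file proves, at the
level of the typed definitions, that the re-typing closes that door:

* `ofReal_two_mul_abs_sub_le_wDist` — two data sets strongly asymptotically flat (DR rates) on the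
  same end `e` with masses `M`, `M'` satisfy `2 · |M − M'| ≤ e.wDist D D'` (as `ENNReal.ofReal`):
  the leading terms differ by `2(M − M')/r · δ`, which the weight `r` of the `C⁰` term of `wDist`
  turns into the constant `2(M − M') δ`, while the remainders are `o(r⁻¹)`;
* `mass_unique` — the mass parameter of an end is unique;
* `tendsto_mass_of_tendsto_wDist` — along ANY family continuous at `0` in `e.wDist`, EVERY
  admissible mass assignment is continuous at `0` (no smoothness, no injectivity, no continuity
  of the mass function assumed);
* `tendsto_mass_of_isTameDataFamily`, `tendsto_admEnergy_of_isTameDataFamily` — along a tame family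
  every mass assignment, in particular the ADM energy `c ↦ admEnergy e (F c)`, is continuous at
  the base parameter; so the clause `Continuous M` of `IsTameDataFamily` is REDUNDANT AT `c = 0`
  (not globally: joint smoothness is local on compacta, a family may re-choose its far field at
  parameters `c ≠ 0`);
* `not_isTameDataFamily_of_mass_jump` — a family of data strongly asymptotically flat on `e` whose
  masses do not tend to the base mass (burial `M(c) → ∞`, rescaling `λ(c) d` with `λ ↛ 1`, any
  per-member re-choice of the mass) is NOT tame on `e`, whatever its smoothness, injectivity or
  immersion — the kernel-checked form of the route text's "burial / rescaling witness families are
  unavailable" for the re-typed rank-5 crux.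

## References

* D. Christodoulou, CQG 16 (1999) A23, p. A24 (the fixed space `𝓐` of data with fixed
  asymptotics; lines `α₀ + c f`).
* M. Dafermos, I. Rodnianski, arXiv:0811.0354, App. B.2.3 (the class `(1 + 2M/r) δ + o₂(r⁻¹)`,
  `o₁(r⁻²)` and its weights).
-/

noncomputable section

-- the doubled `FinalStateConjecture.FinalStateConjecture` path component trips dupNamespace
set_option linter.dupNamespace false
-- instance search through nested operator types `E3 →L[ℝ] E3 →L[ℝ] ℝ` (as in the tree's
-- coordinate-calculus files)
set_option maxSynthPendingDepth 3

open Bundle TopologicalSpace Set Function Filter Metric Asymptotics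
open scoped Manifold ContDiff Topology ENNReal

namespace Summit.FinalStateConjecture.FinalStateConjecture.Theorems.WeakCosmicCensorshipTame.Negative

open Literature.Geometry.Lorentzian
open Literature.Geometry.Lorentzian.InitialDataSet (IsTameDataFamily)

variable {X : Type} [TopologicalSpace X] [ChartedSpace E3 X] [IsManifold (𝓡 3) ∞ X]

/-- **The `C⁰` term of the weighted distance bounds it from below**: for a point `x` beyond the
inner radius of the end, `‖x‖ · ‖hCoeff e D x − hCoeff e D' x‖ ≤ e.wDist D D'`.
[cite: DafermosRodnianski2013, App. B.2.3] -/
theorem ofReal_norm_mul_norm_sub_le_wDist (e : AFEnd X) (D D' : InitialDataSet (𝓡 3) X) {x : E3}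
    (hx : e.R < ‖x‖) :
    ENNReal.ofReal (‖x‖ * ‖AFEnd.hCoeff e D x - AFEnd.hCoeff e D' x‖) ≤ e.wDist D D' := by
  unfold AFEnd.wDist
  refine le_trans ?_ le_self_add
  refine le_trans ?_ (le_iSup₂_of_le (f := fun (m : ℕ) (_ : m ≤ 2) ↦ ⨆ (x : E3) (_ : e.R < ‖x‖),
    ENNReal.ofReal (‖x‖ ^ (1 + m)) *
      ‖iteratedFDeriv ℝ m (fun y ↦ AFEnd.hCoeff e D y - AFEnd.hCoeff e D' y) x‖ₑ) 0 (by norm_num)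
    le_rfl)
  refine le_trans ?_ (le_iSup₂_of_le (f := fun (x : E3) (_ : e.R < ‖x‖) ↦
    ENNReal.ofReal (‖x‖ ^ (1 + 0)) *
      ‖iteratedFDeriv ℝ 0 (fun y ↦ AFEnd.hCoeff e D y - AFEnd.hCoeff e D' y) x‖ₑ) x hx le_rfl)
  rw [← ofReal_norm, norm_iteratedFDeriv_zero, ENNReal.ofReal_mul (norm_nonneg _)]
  simp

/-- **Two data sets strongly asymptotically flat on the same end are at weighted distance at least
twice the difference of their masses**: `2 · |M − M'| ≤ e.wDist D D'`. In the chart of `e`,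
`hCoeff D − hCoeff D' = 2(M − M')/r · δ + (rem_D − rem_{D'})` with `rem = o(r⁻¹)`; evaluating on
`(e₀, e₀)` and weighting by `r` gives `2|M − M'| ≤ r ‖hCoeff D − hCoeff D'‖ + r (‖rem_D‖ + ‖rem_{D'}‖)`,
whose last term is eventually `≤ ε`. Consequently a witness family of the TAME crux cannot leave
the mass level of its base datum discontinuously. [cite: DafermosRodnianski2013, App. B.2.3] -/
theorem ofReal_two_mul_abs_sub_le_wDist (e : AFEnd X) {D D' : InitialDataSet (𝓡 3) X} {M M' : ℝ}
    (hD : e.IsStronglyAsymptoticallyFlatDR D M) (hD' : e.IsStronglyAsymptoticallyFlatDR D' M') :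
    ENNReal.ofReal (2 * |M - M'|) ≤ e.wDist D D' := by
  -- the remainders `rem_D = hCoeff D − (1 + 2M/r) δ`, `rem_{D'}` are `o(r⁻¹)` in `C⁰`
  set δ : E3 →L[ℝ] E3 →L[ℝ] ℝ := innerSL ℝ (E := E3) with hδ
  set f : E3 → E3 →L[ℝ] E3 →L[ℝ] ℝ := fun y ↦ AFEnd.hCoeff e D y - (1 + 2 * M / ‖y‖) • δ with hf
  set f' : E3 → E3 →L[ℝ] E3 →L[ℝ] ℝ := fun y ↦ AFEnd.hCoeff e D' y - (1 + 2 * M' / ‖y‖) • δ with hf'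
  have hof : (fun x ↦ ‖f x‖) =o[Bornology.cobounded E3] fun x ↦ ‖x‖ ^ (-1 : ℝ) := by
    have h := hD.1 0 (by norm_num)
    simp only [Nat.cast_zero, sub_zero, norm_iteratedFDeriv_zero] at h
    exact h
  have hof' : (fun x ↦ ‖f' x‖) =o[Bornology.cobounded E3] fun x ↦ ‖x‖ ^ (-1 : ℝ) := by
    have h := hD'.1 0 (by norm_num)
    simp only [Nat.cast_zero, sub_zero, norm_iteratedFDeriv_zero] at h
    exact h
  refine ENNReal.le_of_forall_pos_le_add fun ε hε _ ↦ ?_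
  have hε2 : (0 : ℝ) < ε / 2 := by positivity
  -- a point far out where both remainders are small and the chart is defined
  have hev : ∀ᶠ x in Bornology.cobounded E3,
      ‖‖f x‖‖ ≤ ε / 2 * ‖‖x‖ ^ (-1 : ℝ)‖ ∧ ‖‖f' x‖‖ ≤ ε / 2 * ‖‖x‖ ^ (-1 : ℝ)‖ ∧ e.R + 1 ≤ ‖x‖ :=
    ((hof.def hε2).and (hof'.def hε2)).and (eventually_cobounded_le_norm (E := E3) (e.R + 1))
      |>.mono fun x h ↦ ⟨h.1.1, h.1.2, h.2⟩
  obtain ⟨x, hx₁, hx₂, hx₃⟩ := hev.exists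
  have hxR : e.R < ‖x‖ := by linarith
  have hx0 : 0 < ‖x‖ := e.R_pos.trans hxR
  have hrpow : ‖x‖ ^ (-1 : ℝ) = ‖x‖⁻¹ := Real.rpow_neg_one ‖x‖
  rw [norm_norm, hrpow, Real.norm_of_nonneg (inv_nonneg.2 hx0.le)] at hx₁ hx₂
  have hb₁ : ‖x‖ * ‖f x‖ ≤ ε / 2 := by
    calc ‖x‖ * ‖f x‖ ≤ ‖x‖ * (ε / 2 * ‖x‖⁻¹) := mul_le_mul_of_nonneg_left hx₁ hx0.le
      _ = ε / 2 := by field_simp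
  have hb₂ : ‖x‖ * ‖f' x‖ ≤ ε / 2 := by
    calc ‖x‖ * ‖f' x‖ ≤ ‖x‖ * (ε / 2 * ‖x‖⁻¹) := mul_le_mul_of_nonneg_left hx₂ hx0.le
      _ = ε / 2 := by field_simp
  -- the algebraic identity `hCoeff D − hCoeff D' = f − f' + (2(M − M')/r) δ`, evaluated on `(e₀, e₀)`
  have hid : AFEnd.hCoeff e D x - AFEnd.hCoeff e D' x = f x - f' x + (2 * (M - M') / ‖x‖) • δ := by
    simp only [hf, hf']
    module
  -- the unit coordinate vector `e₀`, on which `δ(e₀, e₀) = 1`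
  set u₀ : E3 := EuclideanSpace.single (0 : Fin 3) (1 : ℝ) with hu0
  have hn : ‖u₀‖ = 1 := by simp [hu0]
  have hδe : δ u₀ u₀ = 1 := by
    rw [hδ, innerSL_apply_apply, real_inner_self_eq_norm_sq, hn, one_pow]
  have heval : (2 * (M - M') / ‖x‖) =
      (AFEnd.hCoeff e D x - AFEnd.hCoeff e D' x) u₀ u₀ - (f x - f' x) u₀ u₀ := by
    rw [hid]
    simp only [_root_.add_apply, _root_.smul_apply, smul_eq_mul, hδe, mul_one]
    ring
  have hle : |2 * (M - M') / ‖x‖| ≤ ‖AFEnd.hCoeff e D x - AFEnd.hCoeff e D' x‖ + (‖f x‖ + ‖f' x‖) := by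
    rw [heval]
    refine (abs_sub _ _).trans (add_le_add ?_ ?_)
    · have h := (AFEnd.hCoeff e D x - AFEnd.hCoeff e D' x).le_opNorm₂ u₀ u₀
      rw [Real.norm_eq_abs, hn, mul_one, mul_one] at h
      exact h
    · rw [_root_.sub_apply, _root_.sub_apply]
      refine (abs_sub _ _).trans (add_le_add ?_ ?_)
      · have h := (f x).le_opNorm₂ u₀ u₀
        rw [Real.norm_eq_abs, hn, mul_one, mul_one] at h
        exact h
      · have h := (f' x).le_opNorm₂ u₀ u₀
        rw [Real.norm_eq_abs, hn, mul_one, mul_one] at h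
        exact h
  have hmain : 2 * |M - M'| ≤ ‖x‖ * ‖AFEnd.hCoeff e D x - AFEnd.hCoeff e D' x‖ + ε := by
    have h := mul_le_mul_of_nonneg_left hle hx0.le
    rw [abs_div, abs_of_pos hx0, mul_div_cancel₀ _ hx0.ne', abs_mul, abs_two] at h
    linarith [mul_add ‖x‖ ‖AFEnd.hCoeff e D x - AFEnd.hCoeff e D' x‖ (‖f x‖ + ‖f' x‖),
      mul_add ‖x‖ ‖f x‖ ‖f' x‖]
  calc ENNReal.ofReal (2 * |M - M'|)
      ≤ ENNReal.ofReal (‖x‖ * ‖AFEnd.hCoeff e D x - AFEnd.hCoeff e D' x‖ + ε) :=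
        ENNReal.ofReal_le_ofReal hmain
    _ = ENNReal.ofReal (‖x‖ * ‖AFEnd.hCoeff e D x - AFEnd.hCoeff e D' x‖) + ε := by
        rw [ENNReal.ofReal_add (by positivity) ε.coe_nonneg, ENNReal.ofReal_coe_nnreal]
    _ ≤ e.wDist D D' + ε := by
        gcongr
        exact ofReal_norm_mul_norm_sub_le_wDist e D D' hxR

/-- **The mass parameter of a strongly asymptotically flat end is unique** (both candidates are the
ADM energy of the end, `IsStronglyAsymptoticallyFlatDR.admEnergy_eq`; equivalently `wDist D D = 0`
in `ofReal_two_mul_abs_sub_le_wDist`). [cite: DafermosRodnianski2013, App. B.2.3] -/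
theorem mass_unique (e : AFEnd X) {D : InitialDataSet (𝓡 3) X} {M M' : ℝ}
    (hD : e.IsStronglyAsymptoticallyFlatDR D M) (hD' : e.IsStronglyAsymptoticallyFlatDR D M') :
    M = M' := by
  rw [← hD.admEnergy_eq, hD'.admEnergy_eq]

/-- **Along a family continuous at `0` in the weighted distance of an end, EVERY admissible mass
assignment is continuous at `0`.** Nothing else is assumed about the family or the mass function:
the masses are read off the asymptotics and squeezed by `2|M c − M 0| ≤ wDist (F c) (F 0) → 0`.
[cite: Christodoulou1999, p. A24] -/
theorem tendsto_mass_of_tendsto_wDist (e : AFEnd X) {P : Type*} [TopologicalSpace P] [Zero P]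
    {F : P → InitialDataSet (𝓡 3) X} {M : P → ℝ}
    (hM : ∀ c, e.IsStronglyAsymptoticallyFlatDR (F c) (M c))
    (hF : Tendsto (fun c ↦ e.wDist (F c) (F 0)) (𝓝 0) (𝓝 0)) :
    Tendsto M (𝓝 0) (𝓝 (M 0)) := by
  have h1 : Tendsto (fun c ↦ ENNReal.ofReal (2 * |M c - M 0|)) (𝓝 0) (𝓝 0) :=
    tendsto_of_tendsto_of_tendsto_of_le_of_le tendsto_const_nhds hF (fun _ ↦ zero_le)
      fun c ↦ ofReal_two_mul_abs_sub_le_wDist e (hM c) (hM 0)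
  have h2 : Tendsto (fun c ↦ (ENNReal.ofReal (2 * |M c - M 0|)).toReal) (𝓝 0) (𝓝 0) := by
    have h := (ENNReal.tendsto_toReal ENNReal.zero_ne_top).comp h1
    rwa [ENNReal.toReal_zero] at h
  have h3 : Tendsto (fun c ↦ 2 * |M c - M 0|) (𝓝 0) (𝓝 0) :=
    h2.congr fun c ↦ ENNReal.toReal_ofReal (by positivity)
  have h4 : Tendsto (fun c ↦ |M c - M 0|) (𝓝 0) (𝓝 0) := by
    have h := h3.const_mul (1 / 2)
    simp only [mul_zero] at h
    exact h.congr fun c ↦ by ring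
  rw [tendsto_iff_norm_sub_tendsto_zero]
  exact h4.congr fun c ↦ (Real.norm_eq_abs _).symm

variable {e : AFEnd X} {m : ℕ} {F : EuclideanSpace ℝ (Fin m) → InitialDataSet (𝓡 3) X}

/-- **Along a TAME family every admissible mass assignment is continuous at the base parameter** —
not only the family's own mass function, which is continuous by fiat. In particular the clause
`Continuous M` of `InitialDataSet.IsTameDataFamily` is redundant AT `c = 0`: continuity there is
forced by `e.wDist (F c) (F 0) → 0`. (It is not redundant globally: joint smoothness is local on
compacta, so a family may re-choose its far field, hence its mass, discontinuously at parameters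
`c ≠ 0`; the clause excludes exactly those families — harmless for honest witnesses, and fewer
curves for a refuter to trap.) [cite: Christodoulou1999, p. A24] -/
theorem tendsto_mass_of_isTameDataFamily (hF : IsTameDataFamily e m F)
    {M : EuclideanSpace ℝ (Fin m) → ℝ} (hM : ∀ c, e.IsStronglyAsymptoticallyFlatDR (F c) (M c)) :
    Tendsto M (𝓝 0) (𝓝 (M 0)) :=
  tendsto_mass_of_tendsto_wDist e hM hF.2.2.2

/-- **Along a tame family the ADM energy of the end is continuous at the base parameter.**
[cite: DafermosRodnianski2013, App. B.2.3] -/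
theorem tendsto_admEnergy_of_isTameDataFamily (hF : IsTameDataFamily e m F) :
    Tendsto (fun c ↦ e.admEnergy (F c)) (𝓝 0) (𝓝 (e.admEnergy (F 0))) := by
  obtain ⟨M, -, hM⟩ := hF.2.2.1
  have hE : ∀ c, e.admEnergy (F c) = M c := fun c ↦ (hM c).admEnergy_eq
  simp only [hE]
  exact tendsto_mass_of_isTameDataFamily hF hM

/-- **Burial is not tame.** A family of data strongly asymptotically flat on `e` whose masses do NOT
tend to the base mass as `c → 0` — the exact-Kerr burial families of route SwallowTheDatum
(`M(c) → ∞`), a rescaling family `λ(c) · d` with `λ ↛ 1`, any family re-choosing its mass per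
member — is not tame on `e`, whatever its smoothness, injectivity or immersion: the re-typed crux
`WeakCosmicCensorshipTame` does not accept it as a witness. [cite: Christodoulou1999, p. A24] -/
theorem not_isTameDataFamily_of_mass_jump {M : EuclideanSpace ℝ (Fin m) → ℝ}
    (hM : ∀ c, e.IsStronglyAsymptoticallyFlatDR (F c) (M c)) (hjump : ¬ Tendsto M (𝓝 0) (𝓝 (M 0))) :
    ¬ IsTameDataFamily e m F :=
  fun hF ↦ hjump (tendsto_mass_of_isTameDataFamily hF hM)

/-- **Unbounded masses near the base parameter exclude tameness**: if along some sequence of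
parameters `cₙ → 0` the masses `M cₙ` tend to `+∞` (the burial signature), the family is not tame
on `e`. [cite: Christodoulou1999, p. A24] -/
theorem not_isTameDataFamily_of_mass_tendsto_atTop {M : EuclideanSpace ℝ (Fin m) → ℝ}
    (hM : ∀ c, e.IsStronglyAsymptoticallyFlatDR (F c) (M c)) {u : ℕ → EuclideanSpace ℝ (Fin m)}
    (hu : Tendsto u atTop (𝓝 0)) (hdiv : Tendsto (M ∘ u) atTop atTop) :
    ¬ IsTameDataFamily e m F := by
  refine not_isTameDataFamily_of_mass_jump hM fun hconv ↦ ?_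
  have h : Tendsto (M ∘ u) atTop (𝓝 (M 0)) := hconv.comp hu
  exact not_tendsto_atTop_of_tendsto_nhds h hdiv

end Summit.FinalStateConjecture.FinalStateConjecture.Theorems.WeakCosmicCensorshipTame.Negative

end
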